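import Literature.Analysis.FluidPDE.Ferrari1993EnergyInequalityReduction
import Literature.Analysis.FunctionSpaces.SobolevNormSmoothMaps
import HarnessLib

/-!
# The commutator estimate `Ferrari1993_periodicCylinderCommutatorEstimate` from Ferrari's
Lemma 1 ii) (the Moser-type product commutator inequality)

Topic `Literature/Analysis/FluidPDE`. Sixth file of the decomposition of the named fact
`Literature.Analysis.FluidPDE.Ferrari1993_periodicCylinderH3Bound`. The file
`Ferrari1993EnergyInequalityReduction.lean` vendored, as `Ferrari1993_periodicCylinderCommutatorEstimate`,
the *applied* form of the calculus inequality which Ferrari prints between Lemma 1 and (9), p. 280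
("Applying to (8) the second part of the lemma with `f = u` and `g = ∇u` …"):
`‖u·D^α∇u − D^α(u·∇u)‖_{L²} ≤ C |u|_s |u|_{W^{1,∞}}`. Here the lemma itself is vendored —
**Lemma 1 ii)**, p. 280: for `f ∈ H^s(Ω) ∩ C¹(Ω̄)`, `g ∈ H^{s−1}(Ω) ∩ C(Ω̄)` and `|α| ≤ s`,
`‖D^α(fg) − f D^α g‖_{L²(Ω)} ≤ C{|f|_{H^s(Ω)} |g|_{L^∞(Ω)} + |f|_{W^{1,∞}(Ω)} |g|_{H^{s−1}(Ω)}}`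
("easily derived using extension operators … together with the free space versions of the
estimates in [4, 8, 9]" — Beale–Kato–Majda, Klainerman–Majda, Moser) — as the named fact
`Ferrari1993_periodicCylinderMoserInequality`, and the application is **proved**:
`Ferrari1993_periodicCylinderCommutatorEstimate_of_moser`. In the coordinates of the basis
`(eᵢ) = Module.finBasis ℝ ℝ³` of the tree's Sobolev norm, with `vᵢ = ℓᵢ(v)` the coordinate
functions (`ℓᵢ = eᵢ*`) and `gᵢ = ∂_{eᵢ} v`, one has `(v·∇)v = Σᵢ vᵢ gᵢ` and, since `D_w` commutes
with `∂_{eᵢ}` on the open cylinder (`fderiv_iterDeriv_apply_of_isOpen`),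
`[D_w, v·∇]v = Σᵢ (D_w(vᵢ gᵢ) − vᵢ D_w gᵢ)`; Lemma 1 ii) bounds each summand by
`C(‖vᵢ‖_{H³} ‖gᵢ‖_{L^∞} + ‖vᵢ‖_{W^{1,∞}} ‖gᵢ‖_{H²})`, and
`‖vᵢ‖_{W^{k,p}} ≤ ‖ℓᵢ‖ ‖v‖_{W^{k,p}}` (the tree's `FunctionSpaces.eSobolevDomainNorm_clm_comp_le` of
`SobolevNormSmoothMaps.lean`), `‖gᵢ‖_{L^∞} ≤ ‖v‖_{W^{1,∞}}`,
`‖gᵢ‖_{H²} ≤ ‖v‖_{H³}` (one branch of the recursion defining the norm), whence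
`‖[D_w, v·∇]v‖_{L²(cell)} ≤ 2C (Σᵢ ‖ℓᵢ‖) ‖v‖_{W^{1,∞}(cell)} ‖v‖_{H³(cell)}`.

With this file the `H^s` energy inequality, and through it the whole a-priori bound, rests on
Lemma 1 ii), Lemma 2 and the stationary log div–curl estimate
(`Ferrari1993_periodicCylinderH3Bound_of_moser_of_pressure_of_divCurl`); the end-to-end statements
of `Ferrari1993ContinuationAssembly.lean` are re-recorded on this trust base (continuation, BKM in
the periodic cylinder, and `chen_hou_blowup` with Kato–Lai's uniform-time existence and Chen–Hou's
a-priori estimates).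

## Faithfulness / what is NOT here

* The fact renders Lemma 1 ii) for `s = 3` on the open period cell of the periodic cylinder, for
  `f` scalar and `g` vector valued (the case used; the printed lemma is for generic `f, g` and is
  applied with `f = u`, `g = ∇u`), both `C^∞` on the closed cylinder and `L`-periodic (the printed
  regularity `H^s ∩ C¹(Ω̄)`, `H^{s−1} ∩ C(Ω̄)` is weaker, so nothing printed is exceeded), with
  ordered directional derivatives `D_w` along words in the basis `(eᵢ)` for the `D^α` (equivalent
  families up to constants) and the tree's norms on the cell; the full `W^{1,∞}` norm of `f` is
  printed (`|f|_{W^{1,∞}}`). Adaptation caveat as in the sibling facts (bounded smooth domain of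
  `ℝ³` → period cell of the periodic cylinder, a bounded convex domain; extension operators exist
  for it by Stein's theorem).
* Not here: the discharge of the fact (extension to `ℝ³` bounded simultaneously on `H^k` and
  `W^{k,∞}`, and the whole-space Gagliardo–Nirenberg–Moser inequalities).

Mathlib/tree search: whole-space / torus commutator estimates in the tree are
`TorusCommutatorEstimate` (Fourier, torus) only; nothing on domains. The word derivatives
`iterDeriv` of `IteratedSliceDerivatives.lean` are Mathlib's `iteratedFDeriv` evaluated at the
reversed word (bridge `iterDeriv_eq_iteratedFDeriv`, recorded here as asked by the review of that
file); the tree has a second word-derivative vocabulary for scalar functions on `EuclideanSpace ℝ ι`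
along the standard basis, `Literature.Analysis.FluidPDE.ipderiv` (`CoordDerivatives.lean`,
outermost letter first, with its own `ipderiv_eq_iteratedFDeriv`), related by
`iterDeriv m (stdVec ∘ α) f = ipderiv (α ∘ Fin.rev) f` for globally `C^∞` scalar `f` (both equal
`iteratedFDeriv ℝ m f x (stdVec ∘ α ∘ Fin.rev)`); a librarian pass may pick a survivor. The bound
`‖ℓ ∘ f‖_{W^{k,p}(Ω)} ≤ ‖ℓ‖ ‖f‖_{W^{k,p}(Ω)}` is the tree's `eSobolevDomainNorm_clm_comp_le`
(`FunctionSpaces/SobolevNormSmoothMaps.lean`, imported). Used from Mathlib: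
`iteratedFDerivWithin_succ_apply_right`,
`iteratedFDerivWithin_clm_apply_const_apply`, `iteratedFDerivWithin_of_isOpen`,
`Module.Basis.sum_repr`, `Module.Basis.coord`, `LinearMap.toContinuousLinearMap`, `eLpNorm_sum_le`,
`ContinuousLinearMap.hasFDerivAt`.
-/

noncomputable section

open MeasureTheory Set Function Filter Topology TopologicalSpace WithLp
open scoped ContDiff NNReal ENNReal InnerProductSpace RealInnerProductSpace Pointwise

namespace Literature.Analysis.FluidPDE

open Literature.Analysis.FunctionSpaces

/-- Local notation for physical space `ℝ³ = EuclideanSpace ℝ (Fin 3)`. -/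
local notation "ℝ³" => EuclideanSpace ℝ (Fin 3)

/-! ### More calculus of iterated directional derivatives -/

section IterDerivCalculus

variable {E : Type*} [NormedAddCommGroup E] [NormedSpace ℝ E]
variable {F : Type*} [NormedAddCommGroup F] [NormedSpace ℝ F]
variable {F₂ : Type*} [NormedAddCommGroup F₂] [NormedSpace ℝ F₂]

/-- The iterated derivatives of the zero function vanish. [folklore] -/
theorem iterDeriv_fun_zero : ∀ (m : ℕ) (v : Fin m → E), iterDeriv m v (fun _ : E => (0 : F)) = fun _ => 0
  | 0, _ => rfl
  | m + 1, v => by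
    rw [iterDeriv_succ]
    simp only [fderiv_const_apply, zero_apply]
    exact iterDeriv_fun_zero m (Fin.tail v)

/-- **Finite additivity** of iterated derivatives on an open set of smoothness. [folklore] -/
theorem iterDeriv_sum_of_isOpen {ι : Type*} (s : Finset ι) {U : Set E} (hU : IsOpen U) (m : ℕ)
    (v : Fin m → E) {f : ι → E → F} (hf : ∀ i ∈ s, ContDiffOn ℝ ∞ (f i) U) :
    EqOn (iterDeriv m v (fun x => ∑ i ∈ s, f i x)) (fun x => ∑ i ∈ s, iterDeriv m v (f i) x) U := by
  classical
  induction s using Finset.induction_on with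
  | empty =>
    intro x _
    simp only [Finset.sum_empty]
    rw [iterDeriv_fun_zero]
  | insert a s ha ih =>
    intro x hx
    have hfa : ContDiffOn ℝ ∞ (f a) U := hf a (Finset.mem_insert_self a s)
    have hfs : ∀ i ∈ s, ContDiffOn ℝ ∞ (f i) U := fun i hi => hf i (Finset.mem_insert_of_mem hi)
    have hsum : ContDiffOn ℝ ∞ (fun x => ∑ i ∈ s, f i x) U := ContDiffOn.sum fun i hi => hfs i hi
    simp only [Finset.sum_insert ha]
    rw [iterDeriv_add_of_isOpen hU m v hfa hsum hx]
    simp only [ih hfs hx]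

/-- **A continuous linear map passes through iterated derivatives** on an open set of
smoothness: `D_w (ℓ ∘ f) = ℓ ∘ D_w f`. [folklore] -/
theorem iterDeriv_clm_apply_of_isOpen {U : Set E} (hU : IsOpen U) (ℓ : F →L[ℝ] F₂) :
    ∀ (m : ℕ) (v : Fin m → E) {f : E → F}, ContDiffOn ℝ ∞ f U →
      EqOn (iterDeriv m v (fun x => ℓ (f x))) (fun x => ℓ (iterDeriv m v f x)) U
  | 0, _, _, _ => fun _ _ => rfl
  | m + 1, v, f, hf => by
    intro x hx
    rw [iterDeriv_succ, iterDeriv_succ]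
    have h1 : EqOn (fun y => fderiv ℝ (fun x => ℓ (f x)) y (v 0)) (fun y => ℓ (fderiv ℝ f y (v 0))) U := by
      intro y hy
      have hd : DifferentiableAt ℝ f y := differentiableAt_of_contDiffOn_isOpen hU hf hy
      have hc : fderiv ℝ (fun x => ℓ (f x)) y = ℓ.comp (fderiv ℝ f y) :=
        (ℓ.hasFDerivAt.comp y hd.hasFDerivAt).fderiv
      show fderiv ℝ (fun x => ℓ (f x)) y (v 0) = ℓ (fderiv ℝ f y (v 0))
      rw [hc]
      rfl
    rw [iterDeriv_congr_of_isOpen hU m (Fin.tail v) h1 hx]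
    exact iterDeriv_clm_apply_of_isOpen hU ℓ m (Fin.tail v) (contDiffOn_fderiv_apply_of_isOpen hU hf (v 0)) hx

/-- **A first derivative commutes with iterated derivatives** on an open set of smoothness:
`∂_a (D_w f) = D_w (∂_a f)` (mixed partials of `C^∞` functions commute,
`fderiv_fderiv_apply_comm_of_contDiffAt`, iterated). [folklore] -/
theorem fderiv_iterDeriv_apply_of_isOpen {U : Set E} (hU : IsOpen U) (a : E) :
    ∀ (m : ℕ) (v : Fin m → E) {f : E → F}, ContDiffOn ℝ ∞ f U →
      EqOn (fun x => fderiv ℝ (iterDeriv m v f) x a) (iterDeriv m v (fun x => fderiv ℝ f x a)) U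
  | 0, _, _, _ => fun _ _ => rfl
  | m + 1, v, f, hf => by
    intro x hx
    rw [iterDeriv_succ, iterDeriv_succ]
    have hf₀ : ContDiffOn ℝ ∞ (fun x => fderiv ℝ f x (v 0)) U := contDiffOn_fderiv_apply_of_isOpen hU hf (v 0)
    have hfa : ContDiffOn ℝ ∞ (fun x => fderiv ℝ f x a) U := contDiffOn_fderiv_apply_of_isOpen hU hf a
    rw [fderiv_iterDeriv_apply_of_isOpen hU a m (Fin.tail v) hf₀ hx]
    refine iterDeriv_congr_of_isOpen hU m (Fin.tail v) (fun y hy => ?_) hx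
    have hfy : ContDiffAt ℝ ∞ f y := hf.contDiffAt (hU.mem_nhds hy)
    exact fderiv_fderiv_apply_comm_of_contDiffAt hfy a (v 0)

/-- **Bridge to Mathlib's `iteratedFDeriv`**: on an open set of smoothness the iterated directional
derivative along the word `v` is Mathlib's iterated Fréchet derivative within the set evaluated at
the reversed word, `iterDeriv m v f x = iteratedFDerivWithin ℝ m f U x (v ∘ Fin.rev)` (Mathlib
differentiates the *last* argument first, `iteratedFDerivWithin_succ_apply_right`; on open sets
`iteratedFDerivWithin = iteratedFDeriv`, `iteratedFDerivWithin_of_isOpen`). [folklore] -/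
theorem iterDeriv_eq_iteratedFDerivWithin {U : Set E} (hU : IsOpen U) :
    ∀ (m : ℕ) (v : Fin m → E) {f : E → F}, ContDiffOn ℝ ∞ f U → ∀ {x : E}, x ∈ U →
      iterDeriv m v f x = iteratedFDerivWithin ℝ m f U x (v ∘ Fin.rev)
  | 0, v, f, _, x, _ => by simp
  | m + 1, v, f, hf, x, hx => by
    have hUu : UniqueDiffOn ℝ U := hU.uniqueDiffOn
    rw [iterDeriv_succ, iteratedFDerivWithin_succ_apply_right hUu hx]
    have hlast : (v ∘ Fin.rev) (Fin.last m) = v 0 := by simp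
    have hinit : Fin.init (v ∘ Fin.rev) = Fin.tail v ∘ Fin.rev := by
      funext j
      simp [Fin.init, Fin.tail, Fin.rev_castSucc]
    rw [hlast, hinit]
    -- move the evaluation at `v 0` inside
    have hD : ContDiffOn ℝ ∞ (fun y => fderivWithin ℝ f U y) U := hf.fderivWithin hUu (by simp)
    rw [← iteratedFDerivWithin_clm_apply_const_apply hUu hD (by exact_mod_cast le_top) hx]
    -- on the open set, `fderivWithin = fderiv`
    have heq : EqOn (fun y => fderivWithin ℝ f U y (v 0)) (fun y => fderiv ℝ f y (v 0)) U :=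
      fun y hy => by simp only [fderivWithin_of_isOpen hU hy]
    rw [iteratedFDerivWithin_congr heq hx]
    exact iterDeriv_eq_iteratedFDerivWithin hU m (Fin.tail v)
      (contDiffOn_fderiv_apply_of_isOpen hU hf (v 0)) hx

/-- The same bridge with `iteratedFDeriv`: `iterDeriv m v f x = iteratedFDeriv ℝ m f x (v ∘ Fin.rev)`
at points of an open set of smoothness. [folklore] -/
theorem iterDeriv_eq_iteratedFDeriv {U : Set E} (hU : IsOpen U) (m : ℕ) (v : Fin m → E)
    {f : E → F} (hf : ContDiffOn ℝ ∞ f U) {x : E} (hx : x ∈ U) :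
    iterDeriv m v f x = iteratedFDeriv ℝ m f x (v ∘ Fin.rev) := by
  rw [iterDeriv_eq_iteratedFDerivWithin hU m v hf hx, iteratedFDerivWithin_of_isOpen m hU hx]

end IterDerivCalculus

/-! ### The named fact: Ferrari's Lemma 1 ii) -/

/-- **Ferrari's Lemma 1 ii) — the Moser-type product commutator inequality** (Ferrari 1993, Lemma 1
ii), p. 280: "If `f ∈ H^s(Ω) ∩ C¹(Ω̄)` and `g ∈ H^{s−1}(Ω) ∩ C(Ω̄)`, then for `|α| ≤ s`,
`‖D^α(fg) − f D^α g‖_{L²(Ω)} ≤ C{|f|_{H^s(Ω)} |g|_{L^∞(Ω)} + |f|_{W^{1,∞}(Ω)} |g|_{H^{s−1}(Ω)}}`",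
`Ω ⊂ ℝ³` bounded with smooth boundary, `C` depending on `Ω` and `s`; "these estimates are easily
derived using extension operators, well-known to be bounded on the necessary spaces, together with
the free space versions of the estimates" of Beale–Kato–Majda 1984, Klainerman–Majda 1981 and
Moser 1966). **Rendering** (`s = 3`; open period cell `{r < 1} × (0, L)` of the periodic cylinder;
`f` scalar and `g` `ℝ³`-valued, both `C^∞` on the closed cylinder `{r ≤ 1}` and `L`-periodic in
`z`; ordered directional derivatives `D_w = iterDeriv m (sobolevDir w)` along the words `w` of
length `m ≤ 3` in the basis `(eᵢ) = Module.finBasis ℝ ℝ³` of the tree's Sobolev norm for the `D^α`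
— equivalent families up to constants; norms `eSobolevDomainNorm k p (cylinderCell L) volume`,
`H³ = W^{3,2}`, `L^∞ = W^{0,∞}`, `W^{1,∞}`, `H² = W^{2,2}`, in `ℝ≥0∞`): for `L > 0` there is `C`
such that for all such `f, g` and all words of length `≤ 3`,
`‖D_w(f g) − f D_w g‖_{L²(cell)} ≤ C (‖f‖_{H³(cell)} ‖g‖_{L^∞(cell)} + ‖f‖_{W^{1,∞}(cell)} ‖g‖_{H²(cell)})`.
Adaptation caveat as in `Ferrari1993_periodicCylinderH3Bound` (bounded smooth domain of `ℝ³` →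
period cell of the periodic cylinder `{r ≤ 1} × ℝ/Lℤ`, a bounded convex domain, for which
extension operators bounded on all `W^{k,p}` exist by Stein's theorem; Luo–Hou 2014 §4.4,
Chen–Hou 2021 §9). [cite: Ferrari1993, Lemma 1 ii) p. 280]
[cite: LuoHou2014, §4.4 p. 1744 (use in the periodic cylinder)] -/
def Ferrari1993_periodicCylinderMoserInequality : Prop :=
  ∀ (L : ℝ) (_hL : 0 < L), ∃ C : ℝ≥0, ∀ (f : ℝ³ → ℝ) (g : ℝ³ → ℝ³)
    (_hf : ContDiffOn ℝ ∞ f (closure (unitCylinder : Set ℝ³)))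
    (_hg : ContDiffOn ℝ ∞ g (closure (unitCylinder : Set ℝ³)))
    (_hfper : IsAxiallyPeriodic L f) (_hgper : IsAxiallyPeriodic L g)
    (m : ℕ) (_hm : m ≤ 3) (w : Fin m → Fin (Module.finrank ℝ ℝ³)),
    eLpNorm (fun x => iterDeriv m (sobolevDir w) (fun y => f y • g y) x -
        f x • iterDeriv m (sobolevDir w) g x) 2 (volume.restrict (cylinderCell L : Set ℝ³)) ≤
      C * (eSobolevDomainNorm 3 2 (cylinderCell L) volume f * eSobolevDomainNorm 0 ∞ (cylinderCell L) volume g +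
        eSobolevDomainNorm 1 ∞ (cylinderCell L) volume f * eSobolevDomainNorm 2 2 (cylinderCell L) volume g)

/-! ### The reduction -/

/-- The derivative within the closed cylinder of an axially periodic field is axially periodic
(translation invariance of `fderivWithin`, the closed cylinder being translation invariant). [folklore] -/
theorem isAxiallyPeriodic_fderivWithin_apply {F : Type*} [NormedAddCommGroup F] [NormedSpace ℝ F]
    {L : ℝ} {v : ℝ³ → F} (hper : IsAxiallyPeriodic L v) (e : ℝ³) :
    IsAxiallyPeriodic L fun x => fderivWithin ℝ v (closure (unitCylinder : Set ℝ³)) x e := by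
  intro x
  set a : ℝ³ := L • EuclideanSpace.single (2 : Fin 3) (1 : ℝ) with ha
  set K : Set ℝ³ := closure (unitCylinder : Set ℝ³) with hK
  have hvadd : (a +ᵥ K : Set ℝ³) = K := by
    ext y
    rw [Set.mem_vadd_set]
    constructor
    · rintro ⟨z, hz, rfl⟩
      rw [vadd_eq_add, add_comm]
      exact (add_axialShift_mem_closure_unitCylinder_iff L).2 hz
    · intro hy
      refine ⟨y + -a, ?_, by rw [vadd_eq_add]; abel⟩
      have h := (add_axialShift_mem_closure_unitCylinder_iff L (x := y + -a)).1
      rw [← ha, neg_add_cancel_right] at h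
      exact h hy
  have key := fderivWithin_comp_add_right (𝕜 := ℝ) (f := v) (s := K) (x := x) a
  rw [hvadd] at key
  have hfun : (fun y => v (y + a)) = v := funext fun y => hper y
  rw [hfun] at key
  show fderivWithin ℝ v K (x + a) e = fderivWithin ℝ v K x e
  rw [← key]

/-- **`Ferrari1993_periodicCylinderCommutatorEstimate` from Lemma 1 ii).** In the basis
`(eᵢ) = Module.finBasis ℝ ℝ³` with dual functionals `ℓᵢ`, `(v·∇)v = Σᵢ ℓᵢ(v) ∂_{eᵢ}v`, and since
`D_w` commutes with `∂_{eᵢ}` in the open cylinder, `[D_w, v·∇]v = Σᵢ (D_w(ℓᵢ(v) gᵢ) − ℓᵢ(v) D_w gᵢ)`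
with `gᵢ = ∂_{eᵢ} v` (realised up to the boundary as `fderivWithin` on the closed cylinder); apply
the fact to each summand and use `‖ℓᵢ ∘ v‖_{W^{k,p}} ≤ ‖ℓᵢ‖ ‖v‖_{W^{k,p}}`,
`‖gᵢ‖_{L^∞(cell)} ≤ ‖v‖_{W^{1,∞}(cell)}`, `‖gᵢ‖_{H²(cell)} ≤ ‖v‖_{H³(cell)}`; the constant is
`2 C Σᵢ ‖ℓᵢ‖` (Ferrari 1993, p. 280: "Applying to (8) the second part of the lemma with `f = u`
and `g = ∇u`"). [cite: Ferrari1993, Lemma 1 ii) and the display following it, p. 280] -/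
theorem Ferrari1993_periodicCylinderCommutatorEstimate_of_moser
    (hM : Ferrari1993_periodicCylinderMoserInequality) :
    Ferrari1993_periodicCylinderCommutatorEstimate := by
  intro L hL
  obtain ⟨C, hC⟩ := hM L hL
  -- the basis, its dual functionals and the constant
  set ι := Fin (Module.finrank ℝ ℝ³) with hι
  set b : Module.Basis ι ℝ ℝ³ := Module.finBasis ℝ ℝ³ with hb
  set ℓ : ι → (ℝ³ →L[ℝ] ℝ) := fun i => LinearMap.toContinuousLinearMap (b.coord i) with hℓ
  set Λ : ℝ≥0 := ∑ i, ‖ℓ i‖₊ with hΛ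
  refine ⟨2 * C * Λ, ?_⟩
  intro v hv hper m hm w
  -- notation
  set K : Set ℝ³ := closure (unitCylinder : Set ℝ³) with hK_def
  set Ω : Set ℝ³ := (cylinderCell L : Set ℝ³) with hΩ_def
  have hKu : UniqueDiffOn ℝ K := uniqueDiffOn_closure_unitCylinder
  have hU : IsOpen (unitCylinder : Set ℝ³) := unitCylinder.isOpen
  have hΩU : Ω ⊆ (unitCylinder : Set ℝ³) := cylinderCell_le_unitCylinder L
  have hΩmeas : MeasurableSet Ω := (cylinderCell L).isOpen.measurableSet
  have hvU : ContDiffOn ℝ ∞ v (unitCylinder : Set ℝ³) := hv.mono subset_closure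
  have hvΩ : ContDiffOn ℝ ∞ v (cylinderCell L : Set ℝ³) := hvU.mono hΩU
  -- coordinate functions and derivative fields
  set f : ι → ℝ³ → ℝ := fun i x => ℓ i (v x) with hf
  set g : ι → ℝ³ → ℝ³ := fun i x => fderivWithin ℝ v K x (b i) with hg
  have hfs : ∀ i, ContDiffOn ℝ ∞ (f i) K := fun i => (ℓ i).contDiff.comp_contDiffOn hv
  have hgs : ∀ i, ContDiffOn ℝ ∞ (g i) K := fun i =>
    (hv.fderivWithin hKu (by simp)).clm_apply contDiffOn_const
  have hfper : ∀ i, IsAxiallyPeriodic L (f i) := fun i x => by simp only [hf, hper x]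
  have hgper : ∀ i, IsAxiallyPeriodic L (g i) := fun i => isAxiallyPeriodic_fderivWithin_apply hper (b i)
  have hfU : ∀ i, ContDiffOn ℝ ∞ (f i) (unitCylinder : Set ℝ³) := fun i => (hfs i).mono subset_closure
  have hgU' : ∀ i, ContDiffOn ℝ ∞ (g i) (unitCylinder : Set ℝ³) := fun i => (hgs i).mono subset_closure
  have hgU : ∀ i, EqOn (g i) (fun x => fderiv ℝ v x (b i)) (unitCylinder : Set ℝ³) := fun i x hx => by
    show fderivWithin ℝ v (closure (unitCylinder : Set ℝ³)) x (b i) = fderiv ℝ v x (b i)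
    rw [fderivWithin_of_mem_nhds (closure_unitCylinder_mem_nhds hx)]
  have hdvU : ∀ i, ContDiffOn ℝ ∞ (fun x => fderiv ℝ v x (b i)) (unitCylinder : Set ℝ³) := fun i =>
    contDiffOn_fderiv_apply_of_isOpen hU hvU (b i)
  -- the coordinate expansion of a vector applied to a linear map
  have hexp : ∀ (T : ℝ³ →L[ℝ] ℝ³) (y : ℝ³), T y = ∑ i, ℓ i y • T (b i) := fun T y => by
    conv_lhs => rw [← b.sum_repr y]
    simp only [map_sum, map_smul, hℓ, LinearMap.coe_toContinuousLinearMap', Module.Basis.coord_apply]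
  -- the summands of the commutator
  set h : ι → ℝ³ → ℝ³ := fun i x => iterDeriv m (sobolevDir w) (fun y => f i y • g i y) x -
    f i x • iterDeriv m (sobolevDir w) (g i) x with hh
  have hcommU : EqOn (convectionCommutator m w v) (fun x => ∑ i, h i x) (unitCylinder : Set ℝ³) := by
    intro x hx
    rw [convectionCommutator_apply]
    -- `(v·∇)v = Σᵢ fᵢ gᵢ` on the open cylinder
    have hconv : EqOn (convect v v) (fun y => ∑ i, f i y • g i y) (unitCylinder : Set ℝ³) := by
      intro y hy
      rw [convect_apply, hexp (fderiv ℝ v y) (v y)]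
      refine Finset.sum_congr rfl fun i _ => ?_
      simp only [hf, hgU i hy]
    have hprod : ∀ i, ContDiffOn ℝ ∞ (fun y => f i y • g i y) (unitCylinder : Set ℝ³) := fun i =>
      (hfU i).smul (hgU' i)
    rw [iterDeriv_congr_of_isOpen hU m (sobolevDir w) hconv hx,
      iterDeriv_sum_of_isOpen Finset.univ hU m (sobolevDir w) (fun i _ => hprod i) hx]
    -- `(v·∇)(D_w v) = Σᵢ fᵢ ∂_{eᵢ}(D_w v) = Σᵢ fᵢ D_w gᵢ`
    have e2 : fderiv ℝ (iterDeriv m (sobolevDir w) v) x (v x) = ∑ i, f i x • iterDeriv m (sobolevDir w) (g i) x := by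
      rw [hexp (fderiv ℝ (iterDeriv m (sobolevDir w) v) x) (v x)]
      refine Finset.sum_congr rfl fun i _ => ?_
      simp only [hf]
      congr 1
      have h3 := fderiv_iterDeriv_apply_of_isOpen hU (b i) m (sobolevDir w) hvU hx
      simp only at h3
      rw [h3]
      exact iterDeriv_congr_of_isOpen hU m (sobolevDir w) (hgU i).symm hx
    simp only [e2, hh, Finset.sum_sub_distrib]
  -- measurability of the summands on the cell
  have hmeas : ∀ i, AEStronglyMeasurable (h i) (volume.restrict Ω) := fun i => by
    have c1 : ContinuousOn (iterDeriv m (sobolevDir w) (fun y => f i y • g i y)) (unitCylinder : Set ℝ³) :=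
      (ContDiffOn.iterDeriv_of_isOpen hU m (sobolevDir w) ((hfU i).smul (hgU' i))).continuousOn
    have c2 : ContinuousOn (fun x => f i x • iterDeriv m (sobolevDir w) (g i) x) (unitCylinder : Set ℝ³) :=
      (hfU i).continuousOn.smul (ContDiffOn.iterDeriv_of_isOpen hU m (sobolevDir w) (hgU' i)).continuousOn
    exact aestronglyMeasurable_cylinderCell_of_continuousOn L (c1.sub c2)
  -- the four norm comparisons
  set N : ℝ≥0∞ := eSobolevDomainNorm 3 2 (cylinderCell L) volume v with hN
  set Wn : ℝ≥0∞ := eSobolevDomainNorm 1 ∞ (cylinderCell L) volume v with hWn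
  have hN1 : ∀ i, eSobolevDomainNorm 3 2 (cylinderCell L) volume (f i) ≤ ‖ℓ i‖₊ * N := fun i =>
    eSobolevDomainNorm_clm_comp_le (ℓ i) 3 hvΩ
  have hN3 : ∀ i, eSobolevDomainNorm 1 ∞ (cylinderCell L) volume (f i) ≤ ‖ℓ i‖₊ * Wn := fun i =>
    eSobolevDomainNorm_clm_comp_le (ℓ i) 1 hvΩ
  have hgae : ∀ i, (fun x => fderiv ℝ v x (b i)) =ᵐ[volume.restrict Ω] g i := fun i =>
    ae_restrict_of_forall_mem hΩmeas fun x hx => (hgU i (hΩU hx)).symm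
  have hN2 : ∀ i, eSobolevDomainNorm 0 ∞ (cylinderCell L) volume (g i) ≤ Wn := by
    intro i
    rw [hWn, MeyersSerrin.eSobolevDomainNorm_succ_eq (p := ∞) (k := 0)
      (MeyersSerrin.hasWeakFDerivOn_of_contDiffOn (μ := volume) hvΩ),
      ← MeyersSerrin.eSobolevDomainNorm_congr_ae (hgae i)]
    refine le_add_left ?_
    exact Finset.single_le_sum (f := fun j => eSobolevDomainNorm 0 ∞ (cylinderCell L) volume
      fun x => fderiv ℝ v x (Module.finBasis ℝ ℝ³ j)) (fun _ _ => zero_le) (Finset.mem_univ i)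
  have hN4 : ∀ i, eSobolevDomainNorm 2 2 (cylinderCell L) volume (g i) ≤ N := by
    intro i
    rw [hN, MeyersSerrin.eSobolevDomainNorm_succ_eq (p := 2) (k := 2)
      (MeyersSerrin.hasWeakFDerivOn_of_contDiffOn (μ := volume) hvΩ),
      ← MeyersSerrin.eSobolevDomainNorm_congr_ae (hgae i)]
    refine le_add_left ?_
    exact Finset.single_le_sum (f := fun j => eSobolevDomainNorm 2 2 (cylinderCell L) volume
      fun x => fderiv ℝ v x (Module.finBasis ℝ ℝ³ j)) (fun _ _ => zero_le) (Finset.mem_univ i)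
  -- each summand, by the fact
  have hterm : ∀ i, eLpNorm (h i) 2 (volume.restrict Ω) ≤ (2 * C * ‖ℓ i‖₊ : ℝ≥0∞) * Wn * N := by
    intro i
    have key := hC (f i) (g i) (hfs i) (hgs i) (hfper i) (hgper i) m hm w
    refine key.trans ?_
    calc (C : ℝ≥0∞) * (eSobolevDomainNorm 3 2 (cylinderCell L) volume (f i) *
            eSobolevDomainNorm 0 ∞ (cylinderCell L) volume (g i) +
          eSobolevDomainNorm 1 ∞ (cylinderCell L) volume (f i) *
            eSobolevDomainNorm 2 2 (cylinderCell L) volume (g i))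
        ≤ C * ((‖ℓ i‖₊ * N) * Wn + (‖ℓ i‖₊ * Wn) * N) := by
          gcongr
          · exact hN1 i
          · exact hN2 i
          · exact hN3 i
          · exact hN4 i
      _ = (2 * C * ‖ℓ i‖₊ : ℝ≥0∞) * Wn * N := by ring
  -- assemble
  calc eLpNorm (convectionCommutator m w v) 2 (volume.restrict Ω)
      = eLpNorm (fun x => ∑ i, h i x) 2 (volume.restrict Ω) :=
        eLpNorm_congr_ae (ae_restrict_of_forall_mem hΩmeas fun x hx => hcommU (hΩU hx))
    _ = eLpNorm (∑ i, h i) 2 (volume.restrict Ω) := by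
        congr 1
        funext x
        simp only [Finset.sum_apply]
    _ ≤ ∑ i, eLpNorm (h i) 2 (volume.restrict Ω) := eLpNorm_sum_le (fun i _ => hmeas i) one_le_two
    _ ≤ ∑ i, (2 * C * ‖ℓ i‖₊ : ℝ≥0∞) * Wn * N := Finset.sum_le_sum fun i _ => hterm i
    _ = ((2 * C * Λ : ℝ≥0) : ℝ≥0∞) * Wn * N := by
        rw [hΛ]
        push_cast
        rw [Finset.mul_sum, Finset.sum_mul, Finset.sum_mul]

/-- **`Ferrari1993_periodicCylinderHsEnergyInequality` from Lemma 1 ii) and Lemma 2.**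
[cite: Ferrari1993, (8)–(14) with Lemmas 1–2, pp. 280–281] -/
theorem Ferrari1993_periodicCylinderHsEnergyInequality_of_moser_of_pressure
    (hM : Ferrari1993_periodicCylinderMoserInequality)
    (hPE : Ferrari1993_periodicCylinderPressureEstimate) :
    Ferrari1993_periodicCylinderHsEnergyInequality :=
  Ferrari1993_periodicCylinderHsEnergyInequality_of_commutator_of_pressure
    (Ferrari1993_periodicCylinderCommutatorEstimate_of_moser hM) hPE

/-- **`Ferrari1993_periodicCylinderH3Bound` on Lemma 1 ii), Lemma 2 and the stationary log div–curl
estimate** — the end of the decomposition at the granularity of Ferrari's printed lemmas: every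
other step of the proof of (4) ⇒ (7) (pp. 280–282) is proved in the tree. [cite: Ferrari1993, proof of Thm 2, pp. 279–282] -/
theorem Ferrari1993_periodicCylinderH3Bound_of_moser_of_pressure_of_divCurl
    (hM : Ferrari1993_periodicCylinderMoserInequality)
    (hPE : Ferrari1993_periodicCylinderPressureEstimate)
    (hDC : ShirotaYanagisawa1993_periodicCylinderLogDivCurlEstimate) :
    Ferrari1993_periodicCylinderH3Bound :=
  Ferrari1993_periodicCylinderH3Bound_of_commutator_of_pressure_of_divCurl
    (Ferrari1993_periodicCylinderCommutatorEstimate_of_moser hM) hPE hDC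


/-! ### The continuation / BKM chain on the four single-estimate facts -/

/-- **Continuation past a time of bounded vorticity** (`Ferrari1993_periodicCylinderContinuation`,
Ferrari 1993 Thm 2 in the smooth periodic class) on Lemma 1 ii), Lemma 2, the stationary log
div–curl estimate and Kato–Lai's uniform-time existence
(`Ferrari1993_periodicCylinderContinuation_of_H3Bound_of_uniformExistence` with the `H³` bound from
`Ferrari1993_periodicCylinderH3Bound_of_moser_of_pressure_of_divCurl`). [cite: Ferrari1993, Thm 2 (p. 279) and its proof pp. 279–283] -/
theorem Ferrari1993_periodicCylinderContinuation_of_moser_of_pressure_of_divCurl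
    (hM : Ferrari1993_periodicCylinderMoserInequality)
    (hPE : Ferrari1993_periodicCylinderPressureEstimate)
    (hDC : ShirotaYanagisawa1993_periodicCylinderLogDivCurlEstimate)
    (hE : KatoLai1984_periodicCylinderUniformExistence) :
    Ferrari1993_periodicCylinderContinuation :=
  Ferrari1993_periodicCylinderContinuation_of_H3Bound_of_uniformExistence
    (Ferrari1993_periodicCylinderH3Bound_of_moser_of_pressure_of_divCurl hM hPE hDC) hE

/-- **The BKM criterion in the periodic cylinder** (`Ferrari1993_periodicCylinderEulerBKM`) on the
same four facts. [cite: Ferrari1993, Thms 1–2 (p. 279)] -/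
theorem Ferrari1993_periodicCylinderEulerBKM_of_moser_of_pressure_of_divCurl
    (hM : Ferrari1993_periodicCylinderMoserInequality)
    (hPE : Ferrari1993_periodicCylinderPressureEstimate)
    (hDC : ShirotaYanagisawa1993_periodicCylinderLogDivCurlEstimate)
    (hE : KatoLai1984_periodicCylinderUniformExistence) : Ferrari1993_periodicCylinderEulerBKM :=
  Ferrari1993_periodicCylinderEulerBKM_of_H3Bound_of_uniformExistence
    (Ferrari1993_periodicCylinderH3Bound_of_moser_of_pressure_of_divCurl hM hPE hDC) hE

/-- **The Chen–Hou blow-up (`chen_hou_blowup`)** on Lemma 1 ii), Lemma 2, the stationary log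
div–curl estimate, Kato–Lai's uniform-time existence and Chen–Hou's a-priori blow-up estimates —
the trust base of the chain after this decomposition. [cite: arXiv221007191, §1 Theorem 2 (p. 3) and §6.1 Theorem 4 (p. 54)] -/
theorem chen_hou_blowup_of_moser_of_pressure_of_divCurl
    (hM : Ferrari1993_periodicCylinderMoserInequality)
    (hPE : Ferrari1993_periodicCylinderPressureEstimate)
    (hDC : ShirotaYanagisawa1993_periodicCylinderLogDivCurlEstimate)
    (hE : KatoLai1984_periodicCylinderUniformExistence)
    (hCH : ChenHou2022_aprioriBlowupEstimates) : chen_hou_blowup :=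
  chen_hou_blowup_of_H3Bound_of_uniformExistence
    (Ferrari1993_periodicCylinderH3Bound_of_moser_of_pressure_of_divCurl hM hPE hDC) hE hCH

end Literature.Analysis.FluidPDE
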